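/-
Copyright (c) 2026 the pub-hodgecm-mathlib formalisation cell (harness21).  Prover seat hodgecm-mathlib-K2E1-p10 (g2), Track B ∕ K2-LIT (build stream 29), h413 = `stmt-HodgeConjecture-24833`,
route of record `HCCMUnconditional`, ROADCARD «5Res ENDGAME BY FAMILIES» §2 C7, dealer K2E1-plan (g7) deal F3d-ε — FILE ε1∕ε3: AT AN OPEN LEVEL `K′` ONLY FINITELY MANY `χ`-FAMILIES CARRY
`K′`-INVARIANT `χ`-SECTIONS.
-/
import Summits.HodgeConjecture.HodgeConjecture.Theorems.K2E1HeckeCharacterLevelFinitenessU      -- ★ F3d-ε2 (this seat): `finite_setOf_heckeCharacter_trivial_on`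
import Summits.HodgeConjecture.HodgeConjecture.Theorems.K2E1ChiSectionSpaceU2Defs               -- ★ DEFS: `chiSectionSpace`, `firstEntryUnit_eq_diagUnit_zero`
import Literature.NumberTheory.Automorphic.UnitaryGroupTorusLineUnfoldingTwo                    -- ★ `d₀ : T(𝔸) →* 𝕀_E` inline hom, `isOpenMap_diagUnitZeroHom_two`
import HarnessLib

/-!
# h413 ∕ Track B «K2-LIT», ROADCARD «5Res BY FAMILIES» C7, FILE F3d-ε1∕ε3 — helper `K2E1ChiSectionLevelFinitenessU2`: for an open `K′ ≤ U(J₂)(𝔸_F)` with finitely many `(B(𝔸),K′)`-double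
# cosets (representatives `W`), a `K′`-invariant `χ`-section vanishes unless `χ` is trivial on the open LEVEL SUBGROUP `U_w = d₀(T(𝔸) ∩ wK′w⁻¹) ≤ 𝕀_E` of some `w ∈ W`; hence the ray-trivial
# `χ` with `chiSectionSpace χ K′ 1 ≠ ⊥` form a FINITE set `S(K′)` — the finite family index of the C7 exhaustion (K2E4-p14's `β`)

Cell `pub/hodgecm-mathlib`, crux h413 = `stmt-HodgeConjecture-24833`, route of record `HCCMUnconditional`; dealer K2E1-plan (g7) (F3d-ε «=» 13:13Z).  THEOREMS ONLY (no `def`, no `instance`, no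
notation, no named-fact hypothesis, no `sorry`); lane `--supports stmt-HodgeConjecture-24833 --as helper` (count-neutral).  Closes no socket.  Generic quadratic datum `(F, E, c)`, `c² = 1`, `U(J₂)`.
The level subgroup is written INLINE: `U_w := ((K′.map (MulAut.conj w)).comap ι_T).map d₀` with `ι_T : T(𝔸) →* G(𝔸)` the inclusion and `d₀` the inline first-diagonal-entry homomorphism of ★
`UnitaryGroupTorusLineUnfoldingTwo`.

THE MATHEMATICS ([MoeglinWaldspurger1995, I.2.17]; [GelbartJacquet1979Corvallis, §3]).  If `φ ∈ chiSectionSpace χ K′ 1` and `φ(w) ≠ 0`, then for `β ∈ B(𝔸)` with `βw = wk` (`k ∈ K′`):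
`χ(β₀₀)φ(w) = φ(βw) = φ(wk) = φ(w)`, so `χ(β₀₀) = 1`; in particular `χ` is trivial on `U_w` (§1–§2).  `U_w` is OPEN (`K′` open, `d₀` an open map ★), so by ★ F3d-ε2 only finitely many
ray-trivial `χ` are trivial on some `U_w`, `w ∈ W` (§3), and for every other ray-trivial `χ` the space `chiSectionSpace χ K′ 1` is `⊥` (§4: a non-zero section is non-zero at some representative).

* §1 `chi_firstEntryUnit_eq_one_of_apply_ne_zero`, `exists_mem_apply_ne_zero`.  §2 `isOpen_levelSubgroup`, `chi_eq_one_of_mem_levelSubgroup`.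
* §3 **`finite_setOf_rayTrivial_levelTrivial`**.  §4 **`eq_zero_of_mem_chiSectionSpace_of_forall`**, **`chiSectionSpace_eq_bot_of_forall`**.

HONEST LABEL: HC_CM is proved only modulo the 7 printed citations (2 remaining named inputs: hLiu418 = `stmt-HodgeConjecture-24832`, h413 = `stmt-HodgeConjecture-24833`) until rung 0
closes; this file asserts no named fact and closes no socket.
References: [MoeglinWaldspurger1995] C. Mœglin, J.-L. Waldspurger, *Spectral Decomposition and Eisenstein Series*, I.2.17; [GelbartJacquet1979Corvallis] S. Gelbart, H. Jacquet, *Forms of GL(2)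
from the analytic point of view*, §3; [Rogawski1990] J. Rogawski, *Automorphic Representations of Unitary Groups in Three Variables*, §1.10.
-/

set_option autoImplicit false
set_option linter.dupNamespace false  -- the mandated namespace repeats the summit's segment (`HodgeConjecture.HodgeConjecture`)

noncomputable section

open Set Topology NumberField
open Literature.NumberTheory.Automorphic Literature.NumberTheory.Automorphic.UnitaryGroup Literature.NumberTheory.GaloisRepresentations
open Summit.HodgeConjecture.HodgeConjecture.Cruxes.H413.K2E1CharacterEisensteinU2Defs
open Summit.HodgeConjecture.HodgeConjecture.Cruxes.H413.K2E1ChiSectionSpaceU2Defs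
open Summit.HodgeConjecture.HodgeConjecture.Cruxes.H413.K2E1HeckeCharacterLevelFinitenessU (finite_setOf_heckeCharacter_trivial_on)
open scoped NNReal Pointwise

namespace Summit.HodgeConjecture.HodgeConjecture.Cruxes.H413.K2E1ChiSectionLevelFinitenessU2

variable {F E : Type} [Field F] [NumberField F] [Field E] [NumberField E] [Algebra F E] {c : E ≃ₐ[F] E}

/-! ## §1 The vanishing computation -/

/-- **`χ(β₀₀) = 1` ON THE STABILISER OF A POINT WHERE A `K′`-INVARIANT `χ`-SECTION IS NON-ZERO**: `φ ∈ chiSectionSpace χ K′ 1`, `φ(w) ≠ 0`, `β ∈ B(𝔸)`, `βw = wk` with `k ∈ K′`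
⟹ `χ(β₀₀) = 1` (`χ(β₀₀)φ(w) = φ(βw) = φ(wk) = φ(w)`). [cite: MoeglinWaldspurger1995, I.2.17] -/
theorem chi_firstEntryUnit_eq_one_of_apply_ne_zero {χ : HeckeCharacter E} {K' : Subgroup (quasiSplit F E c 2).Adelic}
    {φ : (quasiSplit F E c 2).Adelic → ℂ} (hφ : φ ∈ chiSectionSpace χ K' 1) {w : (quasiSplit F E c 2).Adelic} (hw : φ w ≠ 0)
    {β : (quasiSplit F E c 2).Adelic} (hβ : β ∈ borelAdelic F E c 2) {k : (quasiSplit F E c 2).Adelic} (hk : k ∈ K') (h : β * w = w * k) :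
    χ (firstEntryUnit hβ) = 1 := by
  have h1 : φ (β * w) = ((χ (firstEntryUnit hβ) : ℂˣ) : ℂ) * φ w := (isChiSection_of_mem hφ).borel_mul hβ w
  have h2 : φ (β * w) = φ w := by rw [h, apply_mul_of_mem hφ w ⟨k, hk⟩, Pi.one_apply, one_mul]
  rw [h2] at h1
  exact Units.val_eq_one.1 ((mul_eq_right₀ hw).1 h1.symm)

/-- A non-zero `K′`-invariant `χ`-section is non-zero at some double-coset representative (`φ(βwk) = χ(β₀₀)φ(w)`). [cite: MoeglinWaldspurger1995, I.2.17] -/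
theorem exists_mem_apply_ne_zero {χ : HeckeCharacter E} {K' : Subgroup (quasiSplit F E c 2).Adelic} (W : Finset (quasiSplit F E c 2).Adelic)
    (hW : ∀ g : (quasiSplit F E c 2).Adelic, ∃ β ∈ borelAdelic F E c 2, ∃ w ∈ W, ∃ k ∈ K', g = β * w * k)
    {φ : (quasiSplit F E c 2).Adelic → ℂ} (hφ : φ ∈ chiSectionSpace χ K' 1) (hne : φ ≠ 0) :
    ∃ w ∈ W, φ w ≠ 0 := by
  obtain ⟨g, hg⟩ : ∃ g, φ g ≠ 0 := by
    by_contra hall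
    simp only [not_exists, not_not] at hall
    exact hne (funext hall)
  obtain ⟨β, hβ, w, hw, k, hk, rfl⟩ := hW g
  refine ⟨w, hw, fun hw0 => hg ?_⟩
  rw [mul_assoc, (isChiSection_of_mem hφ).borel_mul hβ, apply_mul_of_mem hφ w ⟨k, hk⟩, Pi.one_apply, one_mul, hw0, mul_zero]

/-! ## §2 The open level subgroup `U_w = d₀(T(𝔸) ∩ w K′ w⁻¹) ≤ 𝕀_E` -/

/-- **`U_w` IS OPEN** (`wK′w⁻¹` open, the inclusion `T(𝔸) → G(𝔸)` continuous, `d₀` an open map ★ `isOpenMap_diagUnitZeroHom_two`). [cite: Rogawski1990, §1.10] -/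
theorem isOpen_levelSubgroup (hc : c * c = 1) {K' : Subgroup (quasiSplit F E c 2).Adelic} (hK'o : IsOpen (K' : Set (quasiSplit F E c 2).Adelic)) (w : (quasiSplit F E c 2).Adelic) :
    IsOpen ((((K'.map (MulAut.conj w).toMonoidHom).comap ((borelAdelic F E c 2).subtype.comp (torusInBorel F E c 2).subtype)).map
      (MonoidHom.mk' (fun t : torusInBorel F E c 2 => diagUnit (t : borelAdelic F E c 2).2 0) (fun t t' => diagUnit_torus_mul_two t t' 0)) :
        Subgroup (ideleGroup E)) : Set (ideleGroup E)) := by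
  rw [Subgroup.coe_map]
  refine isOpenMap_diagUnitZeroHom_two hc _ ?_
  rw [Subgroup.coe_comap]
  refine IsOpen.preimage ((continuous_subtype_val).comp continuous_subtype_val) ?_
  rw [Subgroup.coe_map]
  exact (Homeomorph.mulLeft w).trans (Homeomorph.mulRight w⁻¹) |>.isOpenMap _ hK'o

/-- **`χ` IS TRIVIAL ON `U_w` WHEN A `K′`-INVARIANT `χ`-SECTION IS NON-ZERO AT `w`** (§1 with `β = t ∈ T(𝔸) ∩ wK′w⁻¹`, `t₀₀ = d₀ t`). [cite: MoeglinWaldspurger1995, I.2.17] -/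
theorem chi_eq_one_of_mem_levelSubgroup {χ : HeckeCharacter E} {K' : Subgroup (quasiSplit F E c 2).Adelic}
    {φ : (quasiSplit F E c 2).Adelic → ℂ} (hφ : φ ∈ chiSectionSpace χ K' 1) {w : (quasiSplit F E c 2).Adelic} (hw : φ w ≠ 0)
    {u : ideleGroup E} (hu : u ∈ ((K'.map (MulAut.conj w).toMonoidHom).comap ((borelAdelic F E c 2).subtype.comp (torusInBorel F E c 2).subtype)).map
      (MonoidHom.mk' (fun t : torusInBorel F E c 2 => diagUnit (t : borelAdelic F E c 2).2 0) (fun t t' => diagUnit_torus_mul_two t t' 0))) :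
    χ u = 1 := by
  obtain ⟨t, ht, rfl⟩ := Subgroup.mem_map.1 hu
  obtain ⟨k, hk, hkt⟩ := Subgroup.mem_map.1 (Subgroup.mem_comap.1 ht)
  have h : (((t : torusInBorel F E c 2) : borelAdelic F E c 2) : (quasiSplit F E c 2).Adelic) * w = w * k := by
    have h' : w * k * w⁻¹ = (((t : torusInBorel F E c 2) : borelAdelic F E c 2) : (quasiSplit F E c 2).Adelic) := hkt
    rw [← h', inv_mul_cancel_right]
  have h1 := chi_firstEntryUnit_eq_one_of_apply_ne_zero hφ hw ((t : borelAdelic F E c 2)).2 hk h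
  rwa [firstEntryUnit_eq_diagUnit_zero] at h1

/-! ## §3 The finite family index at level `K′` -/

/-- **FINITELY MANY RAY-TRIVIAL `χ` ARE TRIVIAL ON SOME `U_w`, `w ∈ W`** (`W` finite; ★ F3d-ε2 per `w`). [cite: WeilBNT1967, Ch. IV §4 Thm. 7] -/
theorem finite_setOf_rayTrivial_levelTrivial (hc : c * c = 1) {K' : Subgroup (quasiSplit F E c 2).Adelic} (hK'o : IsOpen (K' : Set (quasiSplit F E c 2).Adelic))
    (W : Finset (quasiSplit F E c 2).Adelic) :
    {χ : HeckeCharacter E | (∀ r : ℝ≥0ˣ, χ (posRealIdele E r) = 1) ∧ ∃ w ∈ W, ∀ u ∈ ((K'.map (MulAut.conj w).toMonoidHom).comap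
        ((borelAdelic F E c 2).subtype.comp (torusInBorel F E c 2).subtype)).map
        (MonoidHom.mk' (fun t : torusInBorel F E c 2 => diagUnit (t : borelAdelic F E c 2).2 0) (fun t t' => diagUnit_torus_mul_two t t' 0)), χ u = 1}.Finite := by
  refine Set.Finite.subset ((W.finite_toSet).biUnion fun w _ => finite_setOf_heckeCharacter_trivial_on E _ (isOpen_levelSubgroup hc hK'o w)) ?_
  rintro χ ⟨hray, w, hw, hχ⟩
  exact Set.mem_biUnion (Finset.mem_coe.2 hw) ⟨hray, hχ⟩

/-! ## §4 The sections of every other family vanish -/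

/-- **A `K′`-INVARIANT `χ`-SECTION VANISHES IF `χ` IS NON-TRIVIAL ON EVERY `U_w`, `w ∈ W`**. [cite: MoeglinWaldspurger1995, I.2.17] -/
theorem eq_zero_of_mem_chiSectionSpace_of_forall {χ : HeckeCharacter E} {K' : Subgroup (quasiSplit F E c 2).Adelic} (W : Finset (quasiSplit F E c 2).Adelic)
    (hW : ∀ g : (quasiSplit F E c 2).Adelic, ∃ β ∈ borelAdelic F E c 2, ∃ w ∈ W, ∃ k ∈ K', g = β * w * k)
    (hχ : ∀ w ∈ W, ∃ u ∈ ((K'.map (MulAut.conj w).toMonoidHom).comap ((borelAdelic F E c 2).subtype.comp (torusInBorel F E c 2).subtype)).map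
        (MonoidHom.mk' (fun t : torusInBorel F E c 2 => diagUnit (t : borelAdelic F E c 2).2 0) (fun t t' => diagUnit_torus_mul_two t t' 0)), χ u ≠ 1)
    {φ : (quasiSplit F E c 2).Adelic → ℂ} (hφ : φ ∈ chiSectionSpace χ K' 1) : φ = 0 := by
  by_contra hne
  obtain ⟨w, hw, hφw⟩ := exists_mem_apply_ne_zero W hW hφ hne
  obtain ⟨u, hu, hχu⟩ := hχ w hw
  exact hχu (chi_eq_one_of_mem_levelSubgroup hφ hφw hu)

/-- **`chiSectionSpace χ K′ 1 = ⊥` FOR `χ` OUTSIDE THE LEVEL-`K′` FAMILIES** — so in the C7 exhaustion `⨆_χ span(gen χ)` only the FINITE set of §3 contributes. [cite: MoeglinWaldspurger1995, I.2.17] -/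
theorem chiSectionSpace_eq_bot_of_forall {χ : HeckeCharacter E} {K' : Subgroup (quasiSplit F E c 2).Adelic} (W : Finset (quasiSplit F E c 2).Adelic)
    (hW : ∀ g : (quasiSplit F E c 2).Adelic, ∃ β ∈ borelAdelic F E c 2, ∃ w ∈ W, ∃ k ∈ K', g = β * w * k)
    (hχ : ∀ w ∈ W, ∃ u ∈ ((K'.map (MulAut.conj w).toMonoidHom).comap ((borelAdelic F E c 2).subtype.comp (torusInBorel F E c 2).subtype)).map
        (MonoidHom.mk' (fun t : torusInBorel F E c 2 => diagUnit (t : borelAdelic F E c 2).2 0) (fun t t' => diagUnit_torus_mul_two t t' 0)), χ u ≠ 1) :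
    chiSectionSpace χ K' (1 : ↥K' → ℂ) = ⊥ :=
  (Submodule.eq_bot_iff _).2 fun _ hφ => eq_zero_of_mem_chiSectionSpace_of_forall W hW hχ hφ

end Summit.HodgeConjecture.HodgeConjecture.Cruxes.H413.K2E1ChiSectionLevelFinitenessU2

end
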